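import Literature.Analysis.FluidPDE.OseenSlabContraction
import HarnessLib

/-!
# Sup-norm perturbation theory of the Oseen integral equation on a time slab, IV:
  physical reading, restart, and slab fields vanishing at spatial infinity

Analysis/FluidPDE file (definitions `slabSlice`, `slabCZero`; everything else proved).
* `slab_perturbation_pointwise`, `slab_full_equation` — the solution `w` of the perturbation
  equation at a background `U` solving `U(t) = e^{(t-a)Δ}U₀ − B_a(U,U)(t)` makes `U + w` a
  solution of the Oseen equation from `a` with datum `U₀ + g`; `slab_restart` — then the Oseen
  equation holds between all pairs of slab times (heat semigroup on bounded data and the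
  semigroup identity `oseenDuhamel_eq_heatExtension_add_of_slab`; Lemarié-Rieusset (9.38));
* `slabCZero` — the closed submodule of slab fields vanishing at spatial infinity uniformly in
  time; it contains `e^{(·-a)Δ}g` for `g → 0` at infinity (`exists_forall_norm_heatFlow_le_of_norm`,
  uniform in bounded time), `B_a(W₁, W₂)` as soon as one factor is in it
  (`Literature.Analysis.FluidPDE.exists_forall_norm_oseenDuhamel_le_of_norm_left/right`), and the
  whole range of `L_a[U]` when the background `U` is in it (Type-I spatial decay of a profile).

## References

* G. Koch, N. Nadirashvili, G. Seregin, V. Šverák, *Liouville theorems for the Navier–Stokes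
  equations and applications*, Acta Math. 203 (2009) = arXiv:0709.3599, §4 (4.3)–(4.4)
  (`u = U + B(u,u)` solved on `L^∞` by a fixed point; `‖B(u,v)‖ ≤ C√T‖u‖‖v‖`).
  [KochNadirashviliSereginSverak2009]
* M. P. Coiculescu, S. Palasek, Invent. Math. 244 (2025) = arXiv:2503.14699, App. B, Prop. B.1
  (the linearised problem in the exponentially weighted sup norm). [CoiculescuPalasek2025]
* D. Henry, *Geometric Theory of Semilinear Parabolic Equations*, LNM 840 (1981), §3.3–3.4
  (differentiable dependence on the data). [Henry1981]
* P. G. Lemarié-Rieusset, *The Navier–Stokes Problem in the 21st Century* (2016), Thm. 9.12,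
  proof, (9.38). [LemarieRieusset2016]
-/

noncomputable section

open MeasureTheory Set Function Filter
open _root_.Topology
open scoped BoundedContinuousFunction

namespace Literature.Analysis.FluidPDE

variable {E : Type*} [NormedAddCommGroup E] [InnerProductSpace ℝ E] [FiniteDimensional ℝ E]
  [MeasurableSpace E] [BorelSpace E]

/-! ### Physical reading: the pointwise equations and the restart identity on the slab -/

section Physical

variable {a b : ℝ} (hab : a ≤ b)

/-- **The slice of a slab field at a slab time**, as a bounded continuous field on `E`. [folklore] -/
def slabSlice (W : (Icc a b) × E →ᵇ E) (t : Icc a b) : E →ᵇ E :=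
  BoundedContinuousFunction.ofNormedAddCommGroup (fun x => W (t, x))
    (W.continuous.comp (continuous_const.prodMk continuous_id)) ‖W‖ (fun _ => W.norm_coe_le_norm _)

omit [InnerProductSpace ℝ E] [FiniteDimensional ℝ E] [MeasurableSpace E] [BorelSpace E] hab in
/-- Values of the slice. [folklore] -/
@[simp]
theorem slabSlice_apply [NormedSpace ℝ E] (W : (Icc a b) × E →ᵇ E) (t : Icc a b) (x : E) :
    slabSlice W t x = W (t, x) := rfl

omit [InnerProductSpace ℝ E] [FiniteDimensional ℝ E] [MeasurableSpace E] [BorelSpace E] in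
/-- The physical field at a slab time is the slice. [folklore] -/
theorem slabPhys_eq_slabSlice [NormedSpace ℝ E] (W : (Icc a b) × E →ᵇ E) {t : ℝ}
    (ht : t ∈ Icc a b) :
    slabPhys hab W t = ⇑(slabSlice W ⟨t, ht⟩) := by
  funext x; rw [slabPhys_of_mem hab W ht, slabSlice_apply]

omit [InnerProductSpace ℝ E] [FiniteDimensional ℝ E] [MeasurableSpace E] [BorelSpace E] hab in
/-- Norm of the slice. [folklore] -/
theorem norm_slabSlice_le [NormedSpace ℝ E] (W : (Icc a b) × E →ᵇ E) (t : Icc a b) :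
    ‖slabSlice W t‖ ≤ ‖W‖ :=
  BoundedContinuousFunction.norm_ofNormedAddCommGroup_le _ (norm_nonneg _) _

/-- **Pointwise form of the perturbation equation.** If `w + L_a[U](w) + B_a(w,w) = e^{(·-a)Δ} g`
as slab fields, then at every slab point
`w(t, x) = e^{(t-a)Δ} g (x) − L_a[U](w)(t)(x) − B_a(w, w)(t)(x)`. [folklore] -/
theorem slab_perturbation_pointwise {U w : (Icc a b) × E →ᵇ E} {g : E →ᵇ E}
    (heq : w + slabLin hab U w + slabBilin hab w w = slabHeat g) {t : ℝ} (ht : t ∈ Icc a b) (x : E) :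
    slabPhys hab w t x = heatFlow (⇑g) (t - a) x -
      linOseen a (slabPhys hab U) (slabPhys hab w) t x -
      oseenDuhamel 1 a (slabPhys hab w) (slabPhys hab w) t x := by
  have h := congrArg (fun W : (Icc a b) × E →ᵇ E => W (⟨t, ht⟩, x)) heq
  simp only [BoundedContinuousFunction.coe_add, Pi.add_apply, slabLin_apply, slabBilin_apply,
    slabHeat_apply] at h
  rw [slabPhys_of_mem hab w ht, eq_sub_iff_add_eq, eq_sub_iff_add_eq, ← h]
  abel

/-- **The full field solves the Oseen equation from the slab start.** If the background `U` solves
`U(t) = e^{(t-a)Δ} U₀ − B_a(U, U)(t)` on the slab and the perturbation `w` solves the perturbation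
equation with datum `g`, then `V = U + w` solves `V(t) = e^{(t-a)Δ}(U₀ + g) − B_a(V, V)(t)` on the
slab (bilinearity of `B_a`, linearity of the heat flow). [folklore] -/
theorem slab_full_equation {U w : (Icc a b) × E →ᵇ E} {U₀ g : E →ᵇ E}
    (hU : ∀ t (ht : t ∈ Icc a b) (x : E), U (⟨t, ht⟩, x) =
      heatFlow (⇑U₀) (t - a) x - oseenDuhamel 1 a (slabPhys hab U) (slabPhys hab U) t x)
    (heq : w + slabLin hab U w + slabBilin hab w w = slabHeat g) {t : ℝ} (ht : t ∈ Icc a b)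
    (x : E) :
    slabPhys hab (U + w) t x = heatFlow (⇑(U₀ + g)) (t - a) x -
      oseenDuhamel 1 a (slabPhys hab (U + w)) (slabPhys hab (U + w)) t x := by
  have hw := slab_perturbation_pointwise hab heq ht x
  have hUt := hU t ht x
  -- expand `B_a(U + w, U + w)`
  have hmU := measurable_uncurry_slabPhys hab U
  have hmw := measurable_uncurry_slabPhys hab w
  have hbU := slabPhys_bound hab U t
  have hbw := slabPhys_bound hab w t
  have hmUw : Measurable (uncurry (slabPhys hab U + slabPhys hab w)) := hmU.add hmw
  have hbUw : ∀ τ ∈ Ioo a t, ∀ y, ‖(slabPhys hab U + slabPhys hab w) τ y‖ ≤ ‖U‖ + ‖w‖ :=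
    fun τ hτ y => (norm_add_le _ _).trans (add_le_add (hbU τ hτ y) (hbw τ hτ y))
  rw [slabPhys_add]
  rw [oseenDuhamel_window_add_left hmU hmw hmUw hbU hbw hbUw x,
    oseenDuhamel_window_add_right hmU hmU hmw hbU hbU hbw x,
    oseenDuhamel_window_add_right hmw hmU hmw hbw hbU hbw x]
  have hheat : heatFlow (⇑U₀ + ⇑g) (t - a) x = heatFlow (⇑U₀) (t - a) x + heatFlow (⇑g) (t - a) x :=
    heatFlow_add_of_bound U₀.continuous g.continuous (fun z => U₀.norm_coe_le_norm z)
      (fun z => g.norm_coe_le_norm z) _ _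
  rw [BoundedContinuousFunction.coe_add, hheat]
  simp only [Pi.add_apply]
  rw [slabPhys_of_mem hab U ht, hUt, hw, linOseen]
  abel

/-- **Restart identity on the slab.** If a slab field `V` solves
`V(t) = e^{(t-a)Δ} V₀ − B_a(V, V)(t)` at every slab time, then for all slab times `s < t`,
`V(t) = e^{(t-s)Δ} V(s) − B_s(V, V)(t)` (heat semigroup on bounded data, linearity, and the
semigroup identity `B_a(t) = e^{(t-s)Δ} B_a(s) + B_s(t)` of the Oseen kernel,
`oseenDuhamel_eq_heatExtension_add_of_slab`; Lemarié-Rieusset 2016, (9.38)).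
[cite: LemarieRieusset2016, Thm. 9.12 (proof, (9.38), PDF p. 260)] -/
theorem slab_restart {V : (Icc a b) × E →ᵇ E} {V₀ : E →ᵇ E}
    (hV : ∀ t (ht : t ∈ Icc a b) (x : E), V (⟨t, ht⟩, x) =
      heatFlow (⇑V₀) (t - a) x - oseenDuhamel 1 a (slabPhys hab V) (slabPhys hab V) t x)
    {s t : ℝ} (hs : s ∈ Icc a b) (hst : s < t) (ht : t ∈ Icc a b) (x : E) :
    V (⟨t, ht⟩, x) = heatFlow (slabPhys hab V s) (t - s) x -
      oseenDuhamel 1 s (slabPhys hab V) (slabPhys hab V) t x := by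
  rcases hs.1.eq_or_lt with h | has
  · -- `s = a`: the slice at `a` is the datum
    subst h
    have h0 : slabPhys hab V a = ⇑V₀ := by
      funext y
      rw [slabPhys_of_mem hab V hs, hV a hs y, sub_self, heatFlow_zero,
        oseenDuhamel_eq_zero_of_le le_rfl, sub_zero]
    rw [h0]; exact hV t ht x
  -- `a < s`
  have hts : 0 < t - s := sub_pos.2 hst
  set Bs : E → E := oseenDuhamel 1 a (slabPhys hab V) (slabPhys hab V) s with hBs
  -- the slice at `s` and its two pieces (bounded continuous)
  have hslice : slabPhys hab V s = fun y => heatFlow (⇑V₀) (s - a) y - Bs y := by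
    funext y; rw [slabPhys_of_mem hab V hs, hV s hs y]
  have hH_cont : Continuous fun y => heatFlow (⇑V₀) (s - a) y :=
    (continuous_uncurry_heatFlow V₀.continuous (fun z => V₀.norm_coe_le_norm z)).comp
      (continuous_const.prodMk continuous_id)
  have hH_bd : ∀ y, ‖heatFlow (⇑V₀) (s - a) y‖ ≤ ‖V₀‖ := fun y =>
    norm_heatFlow_le (fun z => V₀.norm_coe_le_norm z) _ _
  have hB_cont : Continuous Bs := by
    have h := continuousOn_uncurry_oseenDuhamel_slabPhys hab V V
    exact (h.comp_continuous (continuous_const.prodMk continuous_id)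
      (fun y => ⟨hs, mem_univ _⟩) : _)
  have hB_bd : ∀ y, ‖Bs y‖ ≤ oseenSliceConst E * (‖V‖ * ‖V‖) * (2 * Real.sqrt (b - a)) := fun y =>
    norm_oseenDuhamel_slabPhys_le hab V V hs y
  -- heat flow of the slice
  have h1 : heatFlow (slabPhys hab V s) (t - s) x =
      heatFlow (⇑V₀) (t - a) x - heatFlow Bs (t - s) x := by
    rw [hslice, heatFlow_sub_of_bound hH_cont hB_cont hH_bd hB_bd]
    congr 1
    have hsg := heatFlow_heatFlow_holds (E := E) (F := E)
      (UnboundedOperators.memLp_top_of_continuous_of_bound V₀.continuous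
        (fun z => V₀.norm_coe_le_norm z)) le_top (sub_nonneg.2 has.le) hts.le
    have : (fun y => heatFlow (⇑V₀) (s - a) y) = heatFlow (⇑V₀) (s - a) := rfl
    rw [this, hsg]; congr 1; ring
  -- the semigroup identity of the Duhamel term
  have h2 : oseenDuhamel 1 a (slabPhys hab V) (slabPhys hab V) t x =
      heatFlow Bs (t - s) x + oseenDuhamel 1 s (slabPhys hab V) (slabPhys hab V) t x := by
    have h := oseenDuhamel_eq_heatExtension_add_of_slab one_pos (T := b)
      (aestronglyMeasurable_uncurry_slabPhys hab V _) (aestronglyMeasurable_uncurry_slabPhys hab V _)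
      (norm_nonneg V) (norm_nonneg V) (slabPhys_bound hab V b) (slabPhys_bound hab V b) has hst ht.2 x
    rw [h, hBs, heatFlow_of_pos _ hts, one_mul]
  rw [hV t ht x, h1, h2]
  abel

end Physical

/-! ### Slab fields vanishing at spatial infinity uniformly in time -/

section CZero

variable {a b : ℝ} (hab : a ≤ b)

/-- **The submodule of slab fields vanishing at spatial infinity uniformly in time**:
`∀ ε > 0, ∃ R, ∀ (t, x), R ≤ ‖x‖ → ‖W(t, x)‖ ≤ ε`. [folklore] -/
def slabCZero (a b : ℝ) : Submodule ℝ ((Icc a b) × E →ᵇ E) where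
  carrier := {W | ∀ ε : ℝ, 0 < ε → ∃ R : ℝ, ∀ p : (Icc a b) × E, R ≤ ‖p.2‖ → ‖W p‖ ≤ ε}
  zero_mem' := fun ε hε => ⟨0, fun p _ => by simpa using hε.le⟩
  add_mem' := by
    intro W W' hW hW' ε hε
    obtain ⟨R, hR⟩ := hW (ε / 2) (half_pos hε)
    obtain ⟨R', hR'⟩ := hW' (ε / 2) (half_pos hε)
    refine ⟨max R R', fun p hp => ?_⟩
    calc ‖(W + W') p‖ ≤ ‖W p‖ + ‖W' p‖ := norm_add_le _ _
      _ ≤ ε / 2 + ε / 2 := add_le_add (hR p ((le_max_left _ _).trans hp))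
          (hR' p ((le_max_right _ _).trans hp))
      _ = ε := by ring
  smul_mem' := by
    intro r W hW ε hε
    obtain ⟨R, hR⟩ := hW (ε / (‖r‖ + 1)) (by positivity)
    refine ⟨R, fun p hp => ?_⟩
    calc ‖(r • W) p‖ = ‖r‖ * ‖W p‖ := norm_smul _ _
      _ ≤ ‖r‖ * (ε / (‖r‖ + 1)) := mul_le_mul_of_nonneg_left (hR p hp) (norm_nonneg _)
      _ = ε * (‖r‖ / (‖r‖ + 1)) := by ring
      _ ≤ ε * 1 := by gcongr; rw [div_le_one (by positivity)]; linarith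
      _ = ε := mul_one _

omit [FiniteDimensional ℝ E] [MeasurableSpace E] [BorelSpace E] in
/-- Membership in `slabCZero`. [folklore] -/
theorem mem_slabCZero_iff {W : (Icc a b) × E →ᵇ E} :
    W ∈ slabCZero (E := E) a b ↔
      ∀ ε : ℝ, 0 < ε → ∃ R : ℝ, ∀ p : (Icc a b) × E, R ≤ ‖p.2‖ → ‖W p‖ ≤ ε := Iff.rfl

omit [FiniteDimensional ℝ E] [MeasurableSpace E] [BorelSpace E] in
/-- `slabCZero` is closed (a sup-norm limit of uniformly decaying fields decays uniformly).
[folklore] -/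
theorem isClosed_slabCZero :
    IsClosed (slabCZero (E := E) a b : Set ((Icc a b) × E →ᵇ E)) := by
  refine isClosed_of_closure_subset fun W hW ε hε => ?_
  obtain ⟨V, hV, hWV⟩ := Metric.mem_closure_iff.1 hW (ε / 2) (half_pos hε)
  obtain ⟨R, hR⟩ := (hV : V ∈ slabCZero a b) (ε / 2) (half_pos hε)
  refine ⟨R, fun p hp => ?_⟩
  have h1 : ‖W p - V p‖ ≤ ε / 2 := by
    rw [← dist_eq_norm]
    exact (BoundedContinuousFunction.dist_coe_le_dist p).trans hWV.le
  calc ‖W p‖ = ‖(W p - V p) + V p‖ := by rw [sub_add_cancel]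
    _ ≤ ‖W p - V p‖ + ‖V p‖ := norm_add_le _ _
    _ ≤ ε / 2 + ε / 2 := add_le_add h1 (hR p hp)
    _ = ε := by ring

omit [FiniteDimensional ℝ E] [MeasurableSpace E] [BorelSpace E] in
/-- Uniform spatial decay of the physical field of a member of `slabCZero`, in the shape the
radial decay calculus wants. [folklore] -/
theorem slabPhys_decay_of_mem {W : (Icc a b) × E →ᵇ E}
    (hW : W ∈ slabCZero (E := E) a b) (T : ℝ) :
    ∀ η : ℝ, 0 < η → ∃ R : ℝ, ∀ τ ∈ Ioo a T, ∀ y, R ≤ ‖y‖ → ‖slabPhys hab W τ y‖ ≤ η := by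
  intro η hη
  obtain ⟨R, hR⟩ := hW η hη
  refine ⟨R, fun τ _ y hy => ?_⟩
  by_cases hτ : τ ∈ Icc a b
  · rw [slabPhys_of_mem hab W hτ]; exact hR (⟨τ, hτ⟩, y) hy
  · rw [slabPhys_of_not_mem hab W hτ, norm_zero]; exact hη.le

/-- **The bilinear Duhamel operator maps uniformly decaying fields to uniformly decaying fields**
(either slot; `exists_forall_norm_oseenDuhamel_le_of_norm_left`). [folklore] -/
theorem slabBilin_mem_slabCZero_left {W₁ : (Icc a b) × E →ᵇ E} (hW₁ : W₁ ∈ slabCZero (E := E) a b)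
    (W₂ : (Icc a b) × E →ᵇ E) : slabBilin hab W₁ W₂ ∈ slabCZero (E := E) a b := by
  intro ε hε
  obtain ⟨A, hA⟩ := exists_forall_norm_oseenDuhamel_le_of_norm_left (s := a) (T := b)
    (measurable_uncurry_slabPhys hab W₁) (measurable_uncurry_slabPhys hab W₂) (norm_nonneg W₁)
    (norm_nonneg W₂) (slabPhys_bound hab W₁ b) (slabPhys_bound hab W₂ b)
    (slabPhys_decay_of_mem hab hW₁ b) hε
  exact ⟨A, fun p hp => by rw [slabBilin_apply]; exact hA p.1 p.1.2 p.2 hp⟩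

/-- Right-slot twin of `slabBilin_mem_slabCZero_left`. [folklore] -/
theorem slabBilin_mem_slabCZero_right (W₁ : (Icc a b) × E →ᵇ E) {W₂ : (Icc a b) × E →ᵇ E}
    (hW₂ : W₂ ∈ slabCZero (E := E) a b) : slabBilin hab W₁ W₂ ∈ slabCZero (E := E) a b := by
  intro ε hε
  obtain ⟨A, hA⟩ := exists_forall_norm_oseenDuhamel_le_of_norm_right (s := a) (T := b)
    (measurable_uncurry_slabPhys hab W₁) (measurable_uncurry_slabPhys hab W₂) (norm_nonneg W₁)
    (norm_nonneg W₂) (slabPhys_bound hab W₁ b) (slabPhys_bound hab W₂ b)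
    (slabPhys_decay_of_mem hab hW₂ b) hε
  exact ⟨A, fun p hp => by rw [slabBilin_apply]; exact hA p.1 p.1.2 p.2 hp⟩

/-- **The linearised operator at a uniformly decaying background maps every slab field to a
uniformly decaying field** (Type-I spatial decay of the profile). [folklore] -/
theorem slabLin_mem_slabCZero {U : (Icc a b) × E →ᵇ E} (hU : U ∈ slabCZero (E := E) a b)
    (W : (Icc a b) × E →ᵇ E) : slabLin hab U W ∈ slabCZero (E := E) a b := by
  have h : slabLin hab U W = slabBilin hab U W + slabBilin hab W U := by
    simp [slabLin, ContinuousLinearMap.flip_apply]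
  rw [h]
  exact (slabCZero a b).add_mem (slabBilin_mem_slabCZero_left hab hU W)
    (slabBilin_mem_slabCZero_right hab W hU)

/-- **The heat flow of bounded continuous data vanishing at infinity vanishes at infinity
uniformly in bounded time**: `∀ ε > 0, ∃ A, ∀ τ ∈ [0, T], ‖x‖ ≥ A → ‖e^{τΔ}g(x)‖ ≤ ε` (scaling
representation `e^{τΔ}g(x) = ∫ G₁(z) g(x − √τ z) dz`: the data are small at `x − √τ z` for
`‖z‖ ≤ R₁`, `‖x‖ ≥ R₀ + √T R₁`, and the mass of `G₁` off `B(0, R₁)` is small). [folklore] -/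
theorem exists_forall_norm_heatFlow_le_of_norm {g : E → E} {C : ℝ}
    (hC : ∀ z, ‖g z‖ ≤ C) (hdec : ∀ η : ℝ, 0 < η → ∃ R : ℝ, ∀ z, R ≤ ‖z‖ → ‖g z‖ ≤ η)
    (T : ℝ) {ε : ℝ} (hε : 0 < ε) :
    ∃ A : ℝ, ∀ τ ∈ Icc 0 T, ∀ x, A ≤ ‖x‖ → ‖heatFlow g τ x‖ ≤ ε := by
  haveI : CompleteSpace E := FiniteDimensional.complete ℝ E
  have hC0 : 0 ≤ C := (norm_nonneg _).trans (hC 0)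
  obtain ⟨R₀, hR₀⟩ := hdec (ε / 2) (half_pos hε)
  set G : E → ℝ := UnboundedOperators.heatKernel 1 with hG
  have hGi : Integrable G volume := UnboundedOperators.integrable_heatKernel_holds one_pos
  have hG0 : ∀ z, 0 ≤ G z := fun z => (UnboundedOperators.heatKernel_pos one_pos z).le
  have hGint : ∫ z, G z = 1 := UnboundedOperators.integral_heatKernel_eq_one_holds one_pos
  have htail := tendsto_setIntegral_norm_ge_atTop (hGi.mul_const C)
  set θ : ℝ := ε / 2 with hθ
  obtain ⟨R₁, hR₁⟩ := ((htail.eventually (gt_mem_nhds (half_pos hε))).and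
    (eventually_ge_atTop 0)).exists_forall_of_atTop
  refine ⟨R₀ + Real.sqrt T * R₁, fun τ hτ x hx => ?_⟩
  rcases hτ.1.eq_or_lt with h | hτ0
  · -- `τ = 0`: the datum itself
    rw [← h, heatFlow_zero]
    refine (hR₀ x ?_).trans (by linarith)
    have : 0 ≤ Real.sqrt T * R₁ := mul_nonneg (Real.sqrt_nonneg _) (hR₁ R₁ le_rfl).2
    linarith
  rw [heatFlow_of_pos _ hτ0, UnboundedOperators.heatExtension_eq_integral_heatKernel_one hτ0 g x]
  set S : Set E := {z | R₁ ≤ ‖z‖} with hS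
  have hSm : MeasurableSet S := (isClosed_le continuous_const continuous_norm).measurableSet
  -- pointwise bound of the integrand
  have hpt : ∀ z, ‖G z • g (x - Real.sqrt τ • z)‖ ≤ G z * (ε / 2) + S.indicator (fun z => G z * C) z := by
    intro z
    rw [norm_smul, Real.norm_of_nonneg (hG0 z)]
    by_cases hz : z ∈ S
    · rw [indicator_of_mem hz]
      have := mul_le_mul_of_nonneg_left (hC (x - Real.sqrt τ • z)) (hG0 z)
      nlinarith [hG0 z, hε]
    · rw [indicator_of_notMem hz, add_zero]
      refine mul_le_mul_of_nonneg_left (hR₀ _ ?_) (hG0 z)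
      have hz' : ‖z‖ < R₁ := not_le.1 hz
      have hsq : Real.sqrt τ ≤ Real.sqrt T := Real.sqrt_le_sqrt hτ.2
      have h1 : ‖Real.sqrt τ • z‖ ≤ Real.sqrt T * R₁ := by
        rw [norm_smul, Real.norm_of_nonneg (Real.sqrt_nonneg _)]
        exact mul_le_mul hsq hz'.le (norm_nonneg _) (Real.sqrt_nonneg _)
      have h2 : ‖x‖ ≤ ‖x - Real.sqrt τ • z‖ + ‖Real.sqrt τ • z‖ := norm_le_norm_sub_add _ _
      linarith
  have hint1 : Integrable (fun z => G z * (ε / 2)) volume := hGi.mul_const _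
  have hint2 : Integrable (fun z => S.indicator (fun z => G z * C) z) volume :=
    (hGi.mul_const C).indicator hSm
  calc ‖∫ z, G z • g (x - Real.sqrt τ • z)‖
      ≤ ∫ z, (G z * (ε / 2) + S.indicator (fun z => G z * C) z) :=
        norm_integral_le_of_norm_le (hint1.add hint2) (Eventually.of_forall hpt)
    _ = (∫ z, G z) * (ε / 2) + ∫ z in S, G z * C := by
        rw [integral_add hint1 hint2, integral_mul_const, integral_indicator hSm]
    _ ≤ 1 * (ε / 2) + ε / 2 := by
        rw [hGint]
        gcongr
        have h := (hR₁ R₁ le_rfl).1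
        have heq : ∫ z in S, G z * C = ∫ z in {z : E | R₁ ≤ ‖z‖}, G z * C := rfl
        exact le_of_lt h
    _ = ε := by ring

/-- **The heat operator maps data vanishing at infinity to uniformly decaying slab fields.**
[folklore] -/
theorem slabHeat_mem_slabCZero {g : E →ᵇ E} (hg : Tendsto (⇑g) (cocompact E) (𝓝 0)) :
    slabHeat (a := a) (b := b) g ∈ slabCZero (E := E) a b := by
  intro ε hε
  have hdec := (tendsto_cocompact_nhds_zero_iff_norm.1 hg)
  obtain ⟨A, hA⟩ := exists_forall_norm_heatFlow_le_of_norm (fun z => g.norm_coe_le_norm z) hdec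
    (b - a) hε
  refine ⟨A, fun p hp => ?_⟩
  rw [slabHeat_apply]
  exact hA _ ⟨sub_nonneg.2 p.1.2.1, sub_le_sub_right p.1.2.2 a⟩ _ hp

end CZero

end Literature.Analysis.FluidPDE

end
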